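import Mathlib
import Summits.Ventures.PercRepro2.HCov
import Summits.Ventures.PercRepro2.BHKAvoid
import Summits.Ventures.PercRepro2.BHKEvents
import Summits.Ventures.PercRepro2.CrossClusterFunctional
import Summits.Ventures.PercRepro2.RootLeafUHalf
import Summits.Ventures.PercRepro2.RootLeafUMixK
import Summits.Ventures.PercRepro2.RootLeafUMixKA
import Summits.Ventures.PercRepro2.RootLeafUMixHb
import Summits.Ventures.PercRepro2.RootLeafUMixHbThm
import Summits.Ventures.PercRepro2.RootLeafUKMaster
import Summits.Ventures.PercRepro2.RootLeafUKSide
import Summits.Ventures.PercRepro2.RootLeafUKSideSup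

/-!
# The `o ∈ K` half with a CLUSTER-DEPENDENT nested reference: `0 ≤ K3` on the nested class (blind cell
PercRepro2, p4 g28; S3 (G4-u) item (ap), proofs/P4-G28-TPRIME.md §5 / P4-G28-NEST.md)

RootLeafUKSideSup (p4 g27) proves `0 ≤ M·δK + (b)` for every CONSTANT `M` dominating `g(L) = P_{G∖L}(a₂ ↔ b)`
on the clusters `L = C(u) ∋ c`, through the functional BHK06 Thm 1.4 for `φ_M(L) = g(L)·1_{c∈L} + M·1_{c∉L}`,
antitone along nested clusters of `u`.  Here the constant is replaced by a FUNCTION `Ψ : Set V → R` of the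
cluster, with the same antitonicity: `Ψ ≥ 0`, `Ψ` antitone along nested clusters of `u`, and ADMISSIBLE —
`g(L′) ≤ Ψ(L)` whenever `L ⊆ L′` are clusters of `u` with `c ∉ L`, `c ∈ L′` (the least admissible `Ψ` is
`M(L) = sup {g(L′) : L′ ⊇ L, c ∈ L′}`).  Then `φ_Ψ(L) = g(L)·1_{c∈L} + Ψ(L)·1_{c∉L}` is antitone along nested
clusters (`phiPsi_clusterAnti`) and the proof of `KSup.F1M_nonneg` goes through verbatim with the two constants
`M·P(PD)`, `M·P(PD, oK)` replaced by the expectations `E[Ψ(C_u)·1_{PD}]`, `E[Ψ(C_u)·1_{PD, oK}]`: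

* **`F1Psi_nonneg`**: `0 ≤ [W′·E[Ψ(C_u)·1_{PD,oK}] − P(R′,oK)·E[Ψ(C_u)·1_{PD}]] + (b)` — under `P(· | a₂ ↮ {u,c})`,
  `Cov(1_{o∈K}, P(c ∈ L | K)·1_{b∈K}) ≥ −Cov(1_{o∈K}, Ψ(L)·1_{c∉L})` (the constant case is `F1M_nonneg`:
  the bracket is `M·δK`);
* **`K3_nonneg_of_nest`** / **`T2oK_nonneg_of_nest`**: `0 ≤ K3`, hence `0 ≤ T2oK`, whenever
  `2β·[W′·E[Ψ(C_u)·1_{PD,oK}] − P(R′,oK)·E[Ψ(C_u)·1_{PD}]] ≤ A·δK` — the NESTED CLASS; in the cleared covariance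
  form the condition reads `E′[1_{c∉L}·(P(oK | R′) − P(oK | L, c ∉ K))·(Ψ(L) − Λ)] ≥ 0` with `Λ = A/(2β)`,
  and with `Ψ = M(·)` it holds at every known instance outside the constant classes (the extreme-weight
  witnesses LBguc1–4 of p4 g27, where it is nearly tight).
-/

namespace Summit.Ventures.PercRepro2

open UnionCluster CovForm

namespace RootLeafU

namespace KNest

variable {V : Type*} {E : Type*} [Fintype E] [DecidableEq E] [Fintype V] [DecidableEq V]
  {R : Type*} [Field R] [LinearOrder R] [IsStrictOrderedRing R]

section PhiPsi

variable (p : E → R) (ends : E → Sym2 V) (o a₂ c b u : V) (Ψ : Set V → R)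

omit [Fintype V] [DecidableEq V] in
/-- **`φ_Ψ` is antitone along nested clusters of `u`**: `φ_Ψ(L) = g(L)` if `c ∈ L`, `Ψ(L)` if `c ∉ L`, for `Ψ`
antitone along nested clusters and admissible (`g(L′) ≤ Ψ(L)` for `L ⊆ L′`, `c ∉ L`, `c ∈ L′`). -/
lemma phiPsi_clusterAnti (hp : IsProbVec p)
    (hΨanti : ∀ ω ω' : Config E, cluster ends ω u ⊆ cluster ends ω' u →
      Ψ (cluster ends ω' u) ≤ Ψ (cluster ends ω u))
    (hΨadm : ∀ ω ω' : Config E, cluster ends ω u ⊆ cluster ends ω' u → c ∉ cluster ends ω u →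
      c ∈ cluster ends ω' u → delClusterProb p ends a₂ {W : Set V | b ∈ W} (cluster ends ω' u) ≤ Ψ (cluster ends ω u)) :
    ∀ ω ω' : Config E, cluster ends ω u ⊆ cluster ends ω' u →
      (({W : Set V | c ∈ W}).indicator (delClusterProb p ends a₂ {W : Set V | b ∈ W}) (cluster ends ω' u) + ({W : Set V | c ∉ W}).indicator Ψ (cluster ends ω' u)) ≤ (({W : Set V | c ∈ W}).indicator (delClusterProb p ends a₂ {W : Set V | b ∈ W}) (cluster ends ω u) + ({W : Set V | c ∉ W}).indicator Ψ (cluster ends ω u)) := by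
  intro ω ω' h
  have hg := delClusterProb_anti p hp ends a₂ (𝓥 := {W : Set V | b ∈ W}) (fun _ _ h hb => h hb) h
  by_cases hc : c ∈ cluster ends ω u
  · have hc' : c ∈ cluster ends ω' u := h hc
    rw [Set.indicator_of_mem (show cluster ends ω u ∈ {W : Set V | c ∈ W} from hc),
      Set.indicator_of_mem (show cluster ends ω' u ∈ {W : Set V | c ∈ W} from hc'),
      Set.indicator_of_notMem (show cluster ends ω u ∉ {W : Set V | c ∉ W} from fun h' => h' hc),
      Set.indicator_of_notMem (show cluster ends ω' u ∉ {W : Set V | c ∉ W} from fun h' => h' hc')]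
    linarith
  · rw [Set.indicator_of_notMem (show cluster ends ω u ∉ {W : Set V | c ∈ W} from hc),
      Set.indicator_of_mem (show cluster ends ω u ∈ {W : Set V | c ∉ W} from hc)]
    by_cases hc' : c ∈ cluster ends ω' u
    · rw [Set.indicator_of_mem (show cluster ends ω' u ∈ {W : Set V | c ∈ W} from hc'),
        Set.indicator_of_notMem (show cluster ends ω' u ∉ {W : Set V | c ∉ W} from fun h' => h' hc')]
      have := hΨadm ω ω' h hc hc'
      linarith
    · rw [Set.indicator_of_notMem (show cluster ends ω' u ∉ {W : Set V | c ∈ W} from hc'),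
        Set.indicator_of_mem (show cluster ends ω' u ∈ {W : Set V | c ∉ W} from hc')]
      have := hΨanti ω ω' h
      linarith

omit [Fintype V] [DecidableEq V] in
/-- `φ_Ψ ≥ 0` when `Ψ ≥ 0`. -/
lemma phiPsi_nonneg (hp : IsProbVec p) (hΨ0 : ∀ S, 0 ≤ Ψ S) (L : Set V) :
    0 ≤ ({W : Set V | c ∈ W}).indicator (delClusterProb p ends a₂ {W : Set V | b ∈ W}) L +
        ({W : Set V | c ∉ W}).indicator Ψ L := by
  refine add_nonneg (Set.indicator_apply_nonneg fun _ => ?_) (Set.indicator_apply_nonneg fun _ => hΨ0 L)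
  exact delClusterProb_nonneg p hp ends a₂ _ L

omit [LinearOrder R] [IsStrictOrderedRing R] in
/-- **The splitting of `φ_Ψ(L)·1_R`** (pointwise): `φ_Ψ(C_u)·1_{a₂↮{u,c}} = 1_{c∈L}·g(L)·1_{u↮a₂} + Ψ(C_u)·1_{PD}`
(`KSup.phiM_mul_R_eq` with `Ψ(C_u)` in place of `M`). -/
lemma phiPsi_mul_R_eq (ω : Config E) :
    (({W : Set V | c ∈ W}).indicator (delClusterProb p ends a₂ {W : Set V | b ∈ W}) (cluster ends ω u) + ({W : Set V | c ∉ W}).indicator Ψ (cluster ends ω u)) * (avoidAll ends a₂ {u, c}).indicator 1 ω =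
    ({W : Set V | c ∈ W}).indicator (1 : Set V → R) (cluster ends ω u) *
        delClusterProb p ends a₂ {W : Set V | b ∈ W} (cluster ends ω u) *
        (avoidAll ends u {a₂}).indicator 1 ω +
      Ψ (cluster ends ω u) * (PDEvent ends u a₂ c).indicator 1 ω := by
  have hPD : PDEvent ends u a₂ c = avoidAll ends a₂ {u, c} ∩ (connEvent ends u c)ᶜ :=
    (MixK.N_inter_uc_compl_eq ends a₂ c u).symm
  by_cases hc : Conn ends ω u c
  · have h1 : cluster ends ω u ∈ {W : Set V | c ∈ W} := hc
    have h2 : cluster ends ω u ∉ {W : Set V | c ∉ W} := fun h => h hc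
    have h3 : ω ∉ PDEvent ends u a₂ c := by
      rw [hPD]
      exact fun h => h.2 hc
    rw [Set.indicator_of_mem h1, Set.indicator_of_notMem h2, Set.indicator_of_mem h1,
      Set.indicator_of_notMem h3]
    by_cases hR : ω ∈ avoidAll ends a₂ {u, c}
    · rw [Set.indicator_of_mem hR,
        Set.indicator_of_mem ((MixK.mem_R_iff_of_conn ends a₂ c u hc).1 hR)]
      simp
    · rw [Set.indicator_of_notMem hR,
        Set.indicator_of_notMem (fun h => hR ((MixK.mem_R_iff_of_conn ends a₂ c u hc).2 h))]
      simp
  · have h1 : cluster ends ω u ∉ {W : Set V | c ∈ W} := hc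
    have h2 : cluster ends ω u ∈ {W : Set V | c ∉ W} := hc
    rw [Set.indicator_of_notMem h1, Set.indicator_of_mem h2, Set.indicator_of_notMem h1]
    by_cases hR : ω ∈ avoidAll ends a₂ {u, c}
    · have h3 : ω ∈ PDEvent ends u a₂ c := by
        rw [hPD]
        exact ⟨hR, hc⟩
      rw [Set.indicator_of_mem hR, Set.indicator_of_mem h3]
      simp
    · have h3 : ω ∉ PDEvent ends u a₂ c := by
        rw [hPD]
        exact fun h => hR h.1
      rw [Set.indicator_of_notMem hR, Set.indicator_of_notMem h3]
      simp

omit [LinearOrder R] [IsStrictOrderedRing R] in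
/-- **The splitting of `1_{o∈K}·φ_Ψ(L)·1_R`** (pointwise; `KSup.oK_phiM_mul_R_eq` with `Ψ(C_u)`). -/
lemma oK_phiPsi_mul_R_eq (ω : Config E) :
    ({W : Set V | o ∈ W}).indicator (1 : Set V → R) (cluster ends ω a₂) *
      (({W : Set V | c ∈ W}).indicator (delClusterProb p ends a₂ {W : Set V | b ∈ W}) (cluster ends ω u) + ({W : Set V | c ∉ W}).indicator Ψ (cluster ends ω u)) *
      (avoidAll ends a₂ {u, c}).indicator 1 ω =
    ({W : Set V | c ∈ W}).indicator (1 : Set V → R) (cluster ends ω u) *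
        delClusterProb p ends a₂ {W : Set V | b ∈ W} (cluster ends ω u) *
        (connEvent ends a₂ o).indicator 1 ω * (avoidAll ends u {a₂}).indicator 1 ω +
      Ψ (cluster ends ω u) * (PDEvent ends u a₂ c ∩ connEvent ends a₂ o).indicator 1 ω := by
  have h := phiPsi_mul_R_eq p ends a₂ c b u Ψ ω
  rw [MixK.indicator_mem_cluster_eq ends a₂ o ω]
  have e : (PDEvent ends u a₂ c ∩ connEvent ends a₂ o).indicator (1 : Config E → R) ω =
      (PDEvent ends u a₂ c).indicator 1 ω * (connEvent ends a₂ o).indicator 1 ω := by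
    by_cases h1 : ω ∈ PDEvent ends u a₂ c <;> by_cases h2 : ω ∈ connEvent ends a₂ o <;>
      simp [Set.indicator, h1, h2]
  rw [e]
  calc (connEvent ends a₂ o).indicator (1 : Config E → R) ω *
        (({W : Set V | c ∈ W}).indicator (delClusterProb p ends a₂ {W : Set V | b ∈ W}) (cluster ends ω u) + ({W : Set V | c ∉ W}).indicator Ψ (cluster ends ω u)) *
        (avoidAll ends a₂ {u, c}).indicator 1 ω
      = (connEvent ends a₂ o).indicator (1 : Config E → R) ω *
        ((({W : Set V | c ∈ W}).indicator (delClusterProb p ends a₂ {W : Set V | b ∈ W}) (cluster ends ω u) + ({W : Set V | c ∉ W}).indicator Ψ (cluster ends ω u)) *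
        (avoidAll ends a₂ {u, c}).indicator 1 ω) := by ring
    _ = _ := by rw [h]; ring

/-- **`0 ≤ [W′·E[Ψ(C_u)·1_{PD,oK}] − P(R′,oK)·E[Ψ(C_u)·1_{PD}]] + (b)`** for every `Ψ ≥ 0` antitone along nested
clusters of `u` and admissible (`g(L′) ≤ Ψ(L)` for nested clusters `L ⊆ L′` with `c ∉ L`, `c ∈ L′`): the proof of
`KSup.F1M_nonneg` with `φ_Ψ` in place of `φ_M` (`MixK.J0_eq`, `MixK.J_le`,
`KSup.bhk_cross_functional_avoid_clusterAnti`). -/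
theorem F1Psi_nonneg (hp : IsProbVec p) (hΨ0 : ∀ S, 0 ≤ Ψ S)
    (hΨanti : ∀ ω ω' : Config E, cluster ends ω u ⊆ cluster ends ω' u →
      Ψ (cluster ends ω' u) ≤ Ψ (cluster ends ω u))
    (hΨadm : ∀ ω ω' : Config E, cluster ends ω u ⊆ cluster ends ω' u → c ∉ cluster ends ω u →
      c ∈ cluster ends ω' u → delClusterProb p ends a₂ {W : Set V | b ∈ W} (cluster ends ω' u) ≤ Ψ (cluster ends ω u)) :
    0 ≤ ((prob p (PDEvent ends u a₂ c) + prob p (TEvent ends a₂ u c)) * expect p (fun ω => Ψ (cluster ends ω u) * (PDEvent ends u a₂ c ∩ connEvent ends a₂ o).indicator 1 ω) - (prob p (PDEvent ends u a₂ c ∩ connEvent ends a₂ o) + prob p (TEvent ends a₂ u c ∩ connEvent ends a₂ o)) * expect p (fun ω => Ψ (cluster ends ω u) * (PDEvent ends u a₂ c).indicator 1 ω)) + ((prob p (PDEvent ends u a₂ c) + prob p (TEvent ends a₂ u c)) * prob p (TEvent ends a₂ u c ∩ (connEvent ends a₂ o ∩ connEvent ends a₂ b)) - (prob p (PDEvent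 ends u a₂ c ∩ connEvent ends a₂ o) + prob p (TEvent ends a₂ u c ∩ connEvent ends a₂ o)) * prob p (TEvent ends a₂ u c ∩ connEvent ends a₂ b)) := by
  classical
  have hφanti := phiPsi_clusterAnti p ends a₂ c b u Ψ hp hΨanti hΨadm
  have hφ0 := phiPsi_nonneg p ends a₂ c b Ψ hp hΨ0
  have hF₁ : Monotone (({W : Set V | o ∈ W}).indicator (1 : Set V → R)) :=
    monotone_indicator_one_of_isUpperSet (fun _ _ h ho => h ho)
  have hF₁0 : ∀ S, 0 ≤ ({W : Set V | o ∈ W}).indicator (1 : Set V → R) S :=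
    fun S => Set.indicator_apply_nonneg fun _ => zero_le_one
  have hu : u ∈ ({u, c} : Finset V) := by simp
  have key := KSup.bhk_cross_functional_avoid_clusterAnti p ends hp a₂ u hu hF₁ hF₁0 hφanti hφ0
  have e1 : expect p (fun ω => ({W : Set V | o ∈ W}).indicator (1 : Set V → R) (cluster ends ω a₂) *
      (avoidAll ends a₂ {u, c}).indicator 1 ω) =
      prob p (PDEvent ends u a₂ c ∩ connEvent ends a₂ o) +
        prob p (TEvent ends a₂ u c ∩ connEvent ends a₂ o) := by
    rw [← prob_clusterInEvent_inter_eq_expect, ExploreA3.clusterInEvent_mem_eq, Set.inter_comm,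
      MixK.prob_N_inter p ends a₂ c u (connEvent ends a₂ o)]
  have e2 : prob p (avoidAll ends a₂ {u, c}) =
      prob p (PDEvent ends u a₂ c) + prob p (TEvent ends a₂ u c) := by
    have h := MixK.prob_N_inter p ends a₂ c u Set.univ
    simpa only [Set.inter_univ] using h
  have e3 : expect p (fun ω =>
      (({W : Set V | c ∈ W}).indicator (delClusterProb p ends a₂ {W : Set V | b ∈ W}) (cluster ends ω u) + ({W : Set V | c ∉ W}).indicator Ψ (cluster ends ω u)) *
      (avoidAll ends a₂ {u, c}).indicator 1 ω) =
      prob p (TEvent ends a₂ u c ∩ connEvent ends a₂ b) +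
        expect p (fun ω => Ψ (cluster ends ω u) * (PDEvent ends u a₂ c).indicator 1 ω) := by
    have e : (fun ω =>
        (({W : Set V | c ∈ W}).indicator (delClusterProb p ends a₂ {W : Set V | b ∈ W}) (cluster ends ω u) + ({W : Set V | c ∉ W}).indicator Ψ (cluster ends ω u)) *
        (avoidAll ends a₂ {u, c}).indicator 1 ω) =
        fun ω => ({W : Set V | c ∈ W}).indicator (1 : Set V → R) (cluster ends ω u) *
          delClusterProb p ends a₂ {W : Set V | b ∈ W} (cluster ends ω u) *
          (avoidAll ends u {a₂}).indicator 1 ω +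
        Ψ (cluster ends ω u) * (PDEvent ends u a₂ c).indicator 1 ω :=
      funext fun ω => phiPsi_mul_R_eq p ends a₂ c b u Ψ ω
    rw [e, MixK.expect_add_fun p (fun ω => ({W : Set V | c ∈ W}).indicator (1 : Set V → R) (cluster ends ω u) *
          delClusterProb p ends a₂ {W : Set V | b ∈ W} (cluster ends ω u) *
          (avoidAll ends u {a₂}).indicator 1 ω)
        (fun ω => Ψ (cluster ends ω u) * (PDEvent ends u a₂ c).indicator 1 ω),
      MixK.J0_eq]
  have e4 : expect p (fun ω => ({W : Set V | o ∈ W}).indicator (1 : Set V → R) (cluster ends ω a₂) *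
      (({W : Set V | c ∈ W}).indicator (delClusterProb p ends a₂ {W : Set V | b ∈ W}) (cluster ends ω u) + ({W : Set V | c ∉ W}).indicator Ψ (cluster ends ω u)) *
      (avoidAll ends a₂ {u, c}).indicator 1 ω) =
      expect p (fun ω => ({W : Set V | c ∈ W}).indicator (1 : Set V → R) (cluster ends ω u) *
        delClusterProb p ends a₂ {W : Set V | b ∈ W} (cluster ends ω u) *
        (connEvent ends a₂ o).indicator 1 ω * (avoidAll ends u {a₂}).indicator 1 ω) +
        expect p (fun ω => Ψ (cluster ends ω u) * (PDEvent ends u a₂ c ∩ connEvent ends a₂ o).indicator 1 ω) := by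
    have e : (fun ω => ({W : Set V | o ∈ W}).indicator (1 : Set V → R) (cluster ends ω a₂) *
        (({W : Set V | c ∈ W}).indicator (delClusterProb p ends a₂ {W : Set V | b ∈ W}) (cluster ends ω u) + ({W : Set V | c ∉ W}).indicator Ψ (cluster ends ω u)) *
        (avoidAll ends a₂ {u, c}).indicator 1 ω) =
        fun ω => ({W : Set V | c ∈ W}).indicator (1 : Set V → R) (cluster ends ω u) *
          delClusterProb p ends a₂ {W : Set V | b ∈ W} (cluster ends ω u) *
          (connEvent ends a₂ o).indicator 1 ω * (avoidAll ends u {a₂}).indicator 1 ω +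
        Ψ (cluster ends ω u) * (PDEvent ends u a₂ c ∩ connEvent ends a₂ o).indicator 1 ω :=
      funext fun ω => oK_phiPsi_mul_R_eq p ends o a₂ c b u Ψ ω
    rw [e, MixK.expect_add_fun p (fun ω => ({W : Set V | c ∈ W}).indicator (1 : Set V → R) (cluster ends ω u) *
          delClusterProb p ends a₂ {W : Set V | b ∈ W} (cluster ends ω u) *
          (connEvent ends a₂ o).indicator 1 ω * (avoidAll ends u {a₂}).indicator 1 ω)
        (fun ω => Ψ (cluster ends ω u) * (PDEvent ends u a₂ c ∩ connEvent ends a₂ o).indicator 1 ω)]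
  rw [e1, e2, e3, e4] at key
  have hJ := MixK.J_le p ends o a₂ c b u hp
  have hP0 : 0 ≤ prob p (PDEvent ends u a₂ c) + prob p (TEvent ends a₂ u c) :=
    add_nonneg (prob_nonneg hp _) (prob_nonneg hp _)
  have key2 := mul_le_mul_of_nonneg_right (add_le_add_right hJ (expect p (fun ω => Ψ (cluster ends ω u) * (PDEvent ends u a₂ c ∩ connEvent ends a₂ o).indicator 1 ω))) hP0
  nlinarith [key, key2]

/-- **The nested class: `0 ≤ K3 := A·δK + 2β·(b)` whenever `2β·[W′·E[Ψ(C_u)·1_{PD,oK}] − P(R′,oK)·E[Ψ(C_u)·1_{PD}]] ≤ A·δK`**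
for an admissible antitone `Ψ ≥ 0` (the constant `Ψ = M` is `KSup.K3_nonneg_of_A_ge_M`). -/
theorem K3_nonneg_of_nest (hp : IsProbVec p) (hΨ0 : ∀ S, 0 ≤ Ψ S)
    (hΨanti : ∀ ω ω' : Config E, cluster ends ω u ⊆ cluster ends ω' u →
      Ψ (cluster ends ω' u) ≤ Ψ (cluster ends ω u))
    (hΨadm : ∀ ω ω' : Config E, cluster ends ω u ⊆ cluster ends ω' u → c ∉ cluster ends ω u →
      c ∈ cluster ends ω' u → delClusterProb p ends a₂ {W : Set V | b ∈ W} (cluster ends ω' u) ≤ Ψ (cluster ends ω u))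
    (hS : 2 * (prob p Set.univ * prob p (PDEvent ends u a₂ c) + prob p (avoidAll ends a₂ {c}) * prob p (avoidAll ends a₂ {u})) * ((prob p (PDEvent ends u a₂ c) + prob p (TEvent ends a₂ u c)) * expect p (fun ω => Ψ (cluster ends ω u) * (PDEvent ends u a₂ c ∩ connEvent ends a₂ o).indicator 1 ω) - (prob p (PDEvent ends u a₂ c ∩ connEvent ends a₂ o) + prob p (TEvent ends a₂ u c ∩ connEvent ends a₂ o)) * expect p (fun ω => Ψ (cluster ends ω u) * (PDEvent ends u a₂ c).indicator 1 ω)) ≤ ((prob p (PDEvent ends u a₂ c) * prob p (connEvent ends a₂ b) + prob p (avoidAll ends a₂ {c}) * gap p ends u a₂ b) + (prob p Set.univ * EQb3 p ends u a₂ c b + prob p Set.univ * PDb p ends u a₂ c b + prob p (connEvent ends a₂ b) * EQ3 p ends u a₂ c + prob p (connEvent ends a₂ b) * prob p (avoidAll ends a₂ {u}) - (prob p Set.univ - prob p (avoidAll ends a₂ {c})) * gap p ends u a₂ b)) * (prob p (TEvent ends a₂ u c) * prob p (PDEvent ends u a₂ c ∩ connEvent ends a₂ o) - prob p (PDEvent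 ends u a₂ c) * prob p (TEvent ends a₂ u c ∩ connEvent ends a₂ o))) :
    0 ≤ (((prob p (PDEvent ends u a₂ c) * prob p (connEvent ends a₂ b) + prob p (avoidAll ends a₂ {c}) * gap p ends u a₂ b) + (prob p Set.univ * EQb3 p ends u a₂ c b + prob p Set.univ * PDb p ends u a₂ c b + prob p (connEvent ends a₂ b) * EQ3 p ends u a₂ c + prob p (connEvent ends a₂ b) * prob p (avoidAll ends a₂ {u}) - (prob p Set.univ - prob p (avoidAll ends a₂ {c})) * gap p ends u a₂ b)) * (prob p (TEvent ends a₂ u c) * prob p (PDEvent ends u a₂ c ∩ connEvent ends a₂ o) - prob p (PDEvent ends u a₂ c) * prob p (TEvent ends a₂ u c ∩ connEvent ends a₂ o)) + 2 * (prob p Set.univ * prob p (PDEvent ends u a₂ c) + prob p (avoidAll ends a₂ {c}) * prob p (avoidAll ends a₂ {u})) * ((prob p (PDEvent ends u a₂ c) + prob p (TEvent ends a₂ u c)) * prob p (TEvent ends a₂ u c ∩ (connEvent ends a₂ o ∩ connEvent ends a₂ b)) - (prob p (PDEvent ends u a₂ c ∩ connEvent ends a₂ o) + prob p (TEvent ends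 a₂ u c ∩ connEvent ends a₂ o)) * prob p (TEvent ends a₂ u c ∩ connEvent ends a₂ b))) := by
  classical
  have hF := F1Psi_nonneg p ends o a₂ c b u Ψ hp hΨ0 hΨanti hΨadm
  have n_d0 := prob_nonneg hp (avoidAll ends a₂ {c})
  have n_Z := prob_nonneg hp (avoidAll ends a₂ {u})
  have n_D := prob_nonneg hp (PDEvent ends u a₂ c)
  have n_β : 0 ≤ (prob p Set.univ * prob p (PDEvent ends u a₂ c) + prob p (avoidAll ends a₂ {c}) * prob p (avoidAll ends a₂ {u})) := by
    rw [prob_univ]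
    nlinarith [mul_nonneg n_d0 n_Z]
  nlinarith [hS, mul_nonneg n_β hF]

/-- **`0 ≤ T2oK` on the nested class.** -/
theorem T2oK_nonneg_of_nest (hp : IsProbVec p) (hΨ0 : ∀ S, 0 ≤ Ψ S)
    (hΨanti : ∀ ω ω' : Config E, cluster ends ω u ⊆ cluster ends ω' u →
      Ψ (cluster ends ω' u) ≤ Ψ (cluster ends ω u))
    (hΨadm : ∀ ω ω' : Config E, cluster ends ω u ⊆ cluster ends ω' u → c ∉ cluster ends ω u →
      c ∈ cluster ends ω' u → delClusterProb p ends a₂ {W : Set V | b ∈ W} (cluster ends ω' u) ≤ Ψ (cluster ends ω u))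
    (hS : 2 * (prob p Set.univ * prob p (PDEvent ends u a₂ c) + prob p (avoidAll ends a₂ {c}) * prob p (avoidAll ends a₂ {u})) * ((prob p (PDEvent ends u a₂ c) + prob p (TEvent ends a₂ u c)) * expect p (fun ω => Ψ (cluster ends ω u) * (PDEvent ends u a₂ c ∩ connEvent ends a₂ o).indicator 1 ω) - (prob p (PDEvent ends u a₂ c ∩ connEvent ends a₂ o) + prob p (TEvent ends a₂ u c ∩ connEvent ends a₂ o)) * expect p (fun ω => Ψ (cluster ends ω u) * (PDEvent ends u a₂ c).indicator 1 ω)) ≤ ((prob p (PDEvent ends u a₂ c) * prob p (connEvent ends a₂ b) + prob p (avoidAll ends a₂ {c}) * gap p ends u a₂ b) + (prob p Set.univ * EQb3 p ends u a₂ c b + prob p Set.univ * PDb p ends u a₂ c b + prob p (connEvent ends a₂ b) * EQ3 p ends u a₂ c + prob p (connEvent ends a₂ b) * prob p (avoidAll ends a₂ {u}) - (prob p Set.univ - prob p (avoidAll ends a₂ {c})) * gap p ends u a₂ b)) * (prob p (TEvent ends a₂ u c) * prob p (PDEvent ends u a₂ c ∩ connEvent ends a₂ o) - prob p (PDEvent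 ends u a₂ c) * prob p (TEvent ends a₂ u c ∩ connEvent ends a₂ o))) :
    0 ≤ T2oK p ends o a₂ c b u :=
  KSide.T2oK_nonneg_of_K3 p ends o a₂ c b u hp (K3_nonneg_of_nest p ends o a₂ c b u Ψ hp hΨ0 hΨanti hΨadm hS)

end PhiPsi

/-! ### The least admissible reference `M(·)` (p4 g28, appended)

`M(L) = sup {g(C_u(ω′)) : c ∈ C_u(ω′), L ⊆ C_u(ω′)}` (`0` when no configuration extends `L` to a cluster containing
`c`), written as a `Finset.sup'` over all configurations of a set indicator — no decidability, no instance, no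
definition.  `Msup_nonneg`, `Msup_clusterAnti`, `Msup_adm` are its admissibility facts, and
`K3_nonneg_of_nest_sup` / `T2oK_nonneg_of_nest_sup` are the nested class at `Ψ = M(·)`: `0 ≤ K3`, hence `0 ≤ T2oK`,
whenever `2β·[W′·E[M(C_u)·1_{PD,oK}] − P(R′,oK)·E[M(C_u)·1_{PD}]] ≤ A·δK` — the class that holds at the extreme-weight
witnesses LBguc1–4 (nearly tight there); the constant `M* = M(∅)` of `KSup.T2oK_nonneg_of_A_ge_M` dominates `M(·)`,
but the two classes are different (neither contains the other). -/

section Sup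

variable (p : E → R) (ends : E → Sym2 V) (o a₂ c b u : V)

omit [Fintype V] [DecidableEq V] in
/-- The summand of `M(L)` is nonnegative. -/
lemma Msup_term_nonneg (hp : IsProbVec p) (L : Set V) (ν : Config E) :
    0 ≤ ({W : Set V | c ∈ W ∧ L ⊆ W}).indicator (delClusterProb p ends a₂ {W : Set V | b ∈ W}) (cluster ends ν u) :=
  Set.indicator_apply_nonneg fun _ => delClusterProb_nonneg p hp ends a₂ _ _

omit [Fintype V] [DecidableEq V] in
/-- `0 ≤ M(L)`. -/
lemma Msup_nonneg (hp : IsProbVec p) (L : Set V) :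
    0 ≤ (Finset.univ.sup' Finset.univ_nonempty (fun ν : Config E => ({W : Set V | c ∈ W ∧ L ⊆ W}).indicator (delClusterProb p ends a₂ {W : Set V | b ∈ W}) (cluster ends ν u))) :=
  le_trans (Msup_term_nonneg p ends a₂ c b u hp L (fun _ => false))
    (Finset.le_sup' (fun ν : Config E => ({W : Set V | c ∈ W ∧ L ⊆ W}).indicator (delClusterProb p ends a₂ {W : Set V | b ∈ W}) (cluster ends ν u)) (Finset.mem_univ (fun _ => false)))

omit [Fintype V] [DecidableEq V] in
/-- The summand of `M(·)` is antitone in `L` (pointwise in `ν`). -/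
lemma Msup_term_anti (hp : IsProbVec p) {L L' : Set V} (h : L ⊆ L') (ν : Config E) :
    ({W : Set V | c ∈ W ∧ L' ⊆ W}).indicator (delClusterProb p ends a₂ {W : Set V | b ∈ W}) (cluster ends ν u) ≤
      ({W : Set V | c ∈ W ∧ L ⊆ W}).indicator (delClusterProb p ends a₂ {W : Set V | b ∈ W}) (cluster ends ν u) := by
  by_cases hm : cluster ends ν u ∈ {W : Set V | c ∈ W ∧ L' ⊆ W}
  · have hm' : cluster ends ν u ∈ {W : Set V | c ∈ W ∧ L ⊆ W} := ⟨hm.1, h.trans hm.2⟩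
    rw [Set.indicator_of_mem hm, Set.indicator_of_mem hm']
  · rw [Set.indicator_of_notMem hm]
    exact Msup_term_nonneg p ends a₂ c b u hp L ν

omit [Fintype V] [DecidableEq V] in
/-- `M(·)` is antitone along nested clusters of `u` (indeed along `⊆` on all sets). -/
lemma Msup_clusterAnti (hp : IsProbVec p) :
    ∀ ω ω' : Config E, cluster ends ω u ⊆ cluster ends ω' u →
      (Finset.univ.sup' Finset.univ_nonempty (fun ν : Config E => ({W : Set V | c ∈ W ∧ cluster ends ω' u ⊆ W}).indicator (delClusterProb p ends a₂ {W : Set V | b ∈ W}) (cluster ends ν u))) ≤ (Finset.univ.sup' Finset.univ_nonempty (fun ν : Config E => ({W : Set V | c ∈ W ∧ cluster ends ω u ⊆ W}).indicator (delClusterProb p ends a₂ {W : Set V | b ∈ W}) (cluster ends ν u))) := by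
  intro ω ω' h
  refine Finset.sup'_le _ _ fun ν _ => ?_
  exact le_trans (Msup_term_anti p ends a₂ c b u hp h ν)
    (Finset.le_sup' (fun ν : Config E => ({W : Set V | c ∈ W ∧ cluster ends ω u ⊆ W}).indicator (delClusterProb p ends a₂ {W : Set V | b ∈ W}) (cluster ends ν u)) (Finset.mem_univ ν))

omit [Fintype V] [DecidableEq V] [IsStrictOrderedRing R] in
/-- `M(·)` is admissible: `g(L′) ≤ M(L)` for nested clusters `L ⊆ L′` with `c ∉ L`, `c ∈ L′`. -/
lemma Msup_adm :
    ∀ ω ω' : Config E, cluster ends ω u ⊆ cluster ends ω' u → c ∉ cluster ends ω u →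
      c ∈ cluster ends ω' u →
      delClusterProb p ends a₂ {W : Set V | b ∈ W} (cluster ends ω' u) ≤ (Finset.univ.sup' Finset.univ_nonempty (fun ν : Config E => ({W : Set V | c ∈ W ∧ cluster ends ω u ⊆ W}).indicator (delClusterProb p ends a₂ {W : Set V | b ∈ W}) (cluster ends ν u))) := by
  intro ω ω' h _ hc'
  have hm : cluster ends ω' u ∈ {W : Set V | c ∈ W ∧ cluster ends ω u ⊆ W} := ⟨hc', h⟩
  have key := Finset.le_sup' (fun ν : Config E => ({W : Set V | c ∈ W ∧ cluster ends ω u ⊆ W}).indicator (delClusterProb p ends a₂ {W : Set V | b ∈ W}) (cluster ends ν u)) (Finset.mem_univ ω')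
  rw [Set.indicator_of_mem hm] at key
  exact key

/-- **The nested class at `Ψ = M(·)`**: `0 ≤ K3` whenever
`2β·[W′·E[M(C_u)·1_{PD,oK}] − P(R′,oK)·E[M(C_u)·1_{PD}]] ≤ A·δK`. -/
theorem K3_nonneg_of_nest_sup (hp : IsProbVec p) (hS : 2 * (prob p Set.univ * prob p (PDEvent ends u a₂ c) + prob p (avoidAll ends a₂ {c}) * prob p (avoidAll ends a₂ {u})) * ((prob p (PDEvent ends u a₂ c) + prob p (TEvent ends a₂ u c)) * expect p (fun ω => (Finset.univ.sup' Finset.univ_nonempty (fun ν : Config E => ({W : Set V | c ∈ W ∧ cluster ends ω u ⊆ W}).indicator (delClusterProb p ends a₂ {W : Set V | b ∈ W}) (cluster ends ν u))) * (PDEvent ends u a₂ c ∩ connEvent ends a₂ o).indicator 1 ω) - (prob p (PDEvent ends u a₂ c ∩ connEvent ends a₂ o) + prob p (TEvent ends a₂ u c ∩ connEvent ends a₂ o)) * expect p (fun ω => (Finset.univ.sup' Finset.univ_nonempty (fun ν : Config E => ({W : Set V | c ∈ W ∧ cluster ends ω u ⊆ W}).indicator (delClusterProb p ends a₂ {W :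 Set V | b ∈ W}) (cluster ends ν u))) * (PDEvent ends u a₂ c).indicator 1 ω)) ≤ ((prob p (PDEvent ends u a₂ c) * prob p (connEvent ends a₂ b) + prob p (avoidAll ends a₂ {c}) * gap p ends u a₂ b) + (prob p Set.univ * EQb3 p ends u a₂ c b + prob p Set.univ * PDb p ends u a₂ c b + prob p (connEvent ends a₂ b) * EQ3 p ends u a₂ c + prob p (connEvent ends a₂ b) * prob p (avoidAll ends a₂ {u}) - (prob p Set.univ - prob p (avoidAll ends a₂ {c})) * gap p ends u a₂ b)) * (prob p (TEvent ends a₂ u c) * prob p (PDEvent ends u a₂ c ∩ connEvent ends a₂ o) - prob p (PDEvent ends u a₂ c) * prob p (TEvent ends a₂ u c ∩ connEvent ends a₂ o))) :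
    0 ≤ (((prob p (PDEvent ends u a₂ c) * prob p (connEvent ends a₂ b) + prob p (avoidAll ends a₂ {c}) * gap p ends u a₂ b) + (prob p Set.univ * EQb3 p ends u a₂ c b + prob p Set.univ * PDb p ends u a₂ c b + prob p (connEvent ends a₂ b) * EQ3 p ends u a₂ c + prob p (connEvent ends a₂ b) * prob p (avoidAll ends a₂ {u}) - (prob p Set.univ - prob p (avoidAll ends a₂ {c})) * gap p ends u a₂ b)) * (prob p (TEvent ends a₂ u c) * prob p (PDEvent ends u a₂ c ∩ connEvent ends a₂ o) - prob p (PDEvent ends u a₂ c) * prob p (TEvent ends a₂ u c ∩ connEvent ends a₂ o)) + 2 * (prob p Set.univ * prob p (PDEvent ends u a₂ c) + prob p (avoidAll ends a₂ {c}) * prob p (avoidAll ends a₂ {u})) * ((prob p (PDEvent ends u a₂ c) + prob p (TEvent ends a₂ u c)) * prob p (TEvent ends a₂ u c ∩ (connEvent ends a₂ o ∩ connEvent ends a₂ b)) - (prob p (PDEvent ends u a₂ c ∩ connEvent ends a₂ o) + prob p (TEvent ends a₂ u c ∩ connEvent ends a₂ o)) * prob p (TEvent ends a₂ u c ∩ connEvent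 ends a₂ b))) :=
  K3_nonneg_of_nest p ends o a₂ c b u (fun L : Set V => (Finset.univ.sup' Finset.univ_nonempty (fun ν : Config E => ({W : Set V | c ∈ W ∧ L ⊆ W}).indicator (delClusterProb p ends a₂ {W : Set V | b ∈ W}) (cluster ends ν u)))) hp (fun L => Msup_nonneg p ends a₂ c b u hp L)
    (Msup_clusterAnti p ends a₂ c b u hp) (Msup_adm p ends a₂ c b u) hS

/-- **`0 ≤ T2oK` on the nested class at `Ψ = M(·)`.** -/
theorem T2oK_nonneg_of_nest_sup (hp : IsProbVec p) (hS : 2 * (prob p Set.univ * prob p (PDEvent ends u a₂ c) + prob p (avoidAll ends a₂ {c}) * prob p (avoidAll ends a₂ {u})) * ((prob p (PDEvent ends u a₂ c) + prob p (TEvent ends a₂ u c)) * expect p (fun ω => (Finset.univ.sup' Finset.univ_nonempty (fun ν : Config E => ({W : Set V | c ∈ W ∧ cluster ends ω u ⊆ W}).indicator (delClusterProb p ends a₂ {W : Set V | b ∈ W}) (cluster ends ν u))) * (PDEvent ends u a₂ c ∩ connEvent ends a₂ o).indicator 1 ω) - (prob p (PDEvent ends u a₂ c ∩ connEvent ends a₂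 o) + prob p (TEvent ends a₂ u c ∩ connEvent ends a₂ o)) * expect p (fun ω => (Finset.univ.sup' Finset.univ_nonempty (fun ν : Config E => ({W : Set V | c ∈ W ∧ cluster ends ω u ⊆ W}).indicator (delClusterProb p ends a₂ {W : Set V | b ∈ W}) (cluster ends ν u))) * (PDEvent ends u a₂ c).indicator 1 ω)) ≤ ((prob p (PDEvent ends u a₂ c) * prob p (connEvent ends a₂ b) + prob p (avoidAll ends a₂ {c}) * gap p ends u a₂ b) + (prob p Set.univ * EQb3 p ends u a₂ c b + prob p Set.univ * PDb p ends u a₂ c b + prob p (connEvent ends a₂ b) * EQ3 p ends u a₂ c + prob p (connEvent ends a₂ b) * prob p (avoidAll ends a₂ {u}) - (prob p Set.univ - prob p (avoidAll ends a₂ {c})) * gap p ends u a₂ b)) * (prob p (TEvent ends a₂ u c) * prob p (PDEvent ends u a₂ c ∩ connEvent ends a₂ o) - prob p (PDEvent ends u a₂ c) * prob p (TEvent ends a₂ u c ∩ connEvent ends a₂ o))) :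
    0 ≤ T2oK p ends o a₂ c b u :=
  KSide.T2oK_nonneg_of_K3 p ends o a₂ c b u hp (K3_nonneg_of_nest_sup p ends o a₂ c b u hp hS)

end Sup

end KNest

end RootLeafU

end Summit.Ventures.PercRepro2
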